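import Summits.NavierStokesRegularity.FluidComputer.LipRowClock
import Summits.NavierStokesRegularity.FluidComputer.Besov52WeakClock
import Summits.NavierStokesRegularity.FluidComputer.TypeIGradientFace
import Summits.NavierStokesRegularity.FluidComputer.StrainTypeIFace
import Summits.NavierStokesRegularity.FluidComputer.VorticityTypeIFace
import HarnessLib

/-!
# Fluid computer — THE TYPE-I FACE OF THE LEVEL DICTIONARY, ASSEMBLED (L61, L62, L63, L64, L65)

HONEST FRAMING (cell `pub-fluidc`, verbatim): *low prior, high value-of-information experiment on Tao's
machine paradigm; NOT a claim that NS blows up.* Theorem side of the cell (the level dictionary); nothing here is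
evidence of blow-up — necessities for EVERY maximal smooth finite-energy solution on `ℝ³`.

One writer-facing statement collecting the dictionary's necessities at the SELF-SIMILAR RATE `1/(T − t)` — the rows in
which a quantity with the dimension of a rate must be at least a fixed multiple of `1/(T − t)`, with NO viscosity and
NO energy in the constant. Along every maximal smooth solution `(u, p)` of the unforced Navier–Stokes system on
`ℝ³ × [0, T)` (`ν > 0`) which is Leray–Hopf from `u 0`:

* (L61, STRONG — at every `t ∈ (0, T)`) `c₁/(T − t) ≤ ∑_l 2^{5l/2}‖Δ̇_l u(t)‖₂` (`≃ ‖u(t)‖_{Ḃ^{5/2}_{2,1}}`), `c₁` absolute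
  (`LipRowClock.lipRow_clock`, McCormick et al. 2016 Thm 1.1);
* (L62, WEAK — along a sequence) `c₂/(T − b) < ‖u(b)‖_{Ḣ^{5/2}}` at times `b` arbitrarily close to `T`, `c₂` absolute
  (`Besov52WeakClock.homSobolev52_weak_clock`, McCormick et al. 2016 Thm 3.2);
* (L63, WEAK, EXPLICIT) `(T − t)·‖∇u(t, x)‖ > M₀` somewhere on every terminal window, for EVERY `M₀ < 1`
  (`TypeIGradientFace.ns_typeI_gradient_threshold`, Chae's threshold);
* (L64, WEAK, EXPLICIT) `λ₂(∇u(t, x)) > ε/(T − t)` somewhere on every terminal window, for EVERY `ε < 1/4`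
  (`StrainTypeIFace.ns_midStrain_typeI_threshold`, Miller × Leray);
* (L65, WEAK, EXPLICIT) `(T − t)·‖ω(t, x)‖ > ε` somewhere on every terminal window, for EVERY `ε < 1/4`
  (`VorticityTypeIFace.ns_vorticity_typeI_threshold`, Robinson–Rodrigo–Sadowski (12.12) × Leray).

* `typeI_face` — the conjunction; `typeI_face_of_cascadeWitness` — the interface reading.

Reading for the machine paradigm: a run approaching a genuine singularity at an extrapolated `T` shows, on log axes
against `T − t`, the `Ḃ^{5/2}_{2,1}` row ABOVE a slope `−1` line at all times, and the four curves `(T − t)‖u‖_{Ḣ^{5/2}}`,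
`(T − t)max|∇u|`, `(T − t)sup λ₂`, `(T − t)max|ω|` returning above `c₂`, `1`, `1/4`, `1/4` respectively again and again.
Necessity only; the weak rows are NOT claimed at every `t`; the explicit constants are NOT claimed optimal. 0 sorry; no
definitions; no named facts.

## References

* D. S. McCormick et al., SIAM J. Math. Anal. 48 (2016) 2119–2132 = arXiv:1503.04323, Thm 1.1, Thm 3.2.
  [MccormickEtAl2016]
* D. Chae, J. Funct. Anal. 258 (2010) 2865–2883, Thm 1.1. [Chae2010]
* E. Miller, Arch. Ration. Mech. Anal. 237 (2020) 1237–1263, Thm 1.1. [Miller2019]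
* J. C. Robinson, J. L. Rodrigo, W. Sadowski, CUP 2016, Thm 12.3, Lemma 6.11. [RobinsonRodrigoSadowski2016]
-/

noncomputable section

open MeasureTheory Set Function Filter Topology Metric
open scoped ENNReal NNReal RealInnerProductSpace
open Literature.Analysis.FluidPDE Literature.Analysis.FunctionSpaces
open Literature.Analysis.FluidPDE.FluidComputer
open Summit.NavierStokesRegularity.NavierStokesRegularity.Theorems.FluidComputer (x5a_of_cascadeWitness')
open Summit.NavierStokesRegularity.FluidComputer.LipRowClock (lipRow_clock)
open Summit.NavierStokesRegularity.FluidComputer.Besov52WeakClock (homSobolev52_weak_clock)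
open Summit.NavierStokesRegularity.FluidComputer.TypeIGradientFace (ns_typeI_gradient_threshold)
open Summit.NavierStokesRegularity.FluidComputer.StrainTypeIFace (ns_midStrain_typeI_threshold)
open Summit.NavierStokesRegularity.FluidComputer.VorticityTypeIFace (ns_vorticity_typeI_threshold)

namespace Summit.NavierStokesRegularity.FluidComputer.TypeIFace

/-- **THE TYPE-I FACE, ASSEMBLED.** There are ABSOLUTE constants `c₁, c₂ > 0` such that for every `ν > 0`, `T > 0`
and every maximal smooth solution `(u, p)` of the unforced Navier–Stokes system on `ℝ³ × [0, T)` which is Leray–Hopf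
from `u 0`: (L61) `c₁(T − t)^{−1} ≤ ∑_l 2^{5l/2}‖Δ̇_l u(t)‖₂` at EVERY `t ∈ (0, T)`; (L62) for every `t₀ < T` some
`b ∈ (t₀, T) ∩ (0, T)` has `c₂/(T − b) < ‖u(b)‖_{Ḣ^{5/2}}`; (L63) for every `M₀ < 1` and `t₀ ∈ [0, T)` some
`t ∈ [t₀, T)`, `x` have `M₀ < (T − t)‖∇u(t, x)‖`; (L64) for every `ε < 1/4` and `a ∈ [0, T)` some `t ∈ [a, T)`, `x` have,
on every 2-plane, a direction `ξ = αv + βw` with `ε(α² + β²)/(T − t) < ⟪∇u(t, x)ξ, ξ⟫`; (L65) for every `ε < 1/4` and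
`a ∈ [0, T)` some `t ∈ [a, T)`, `x` have `ε < (T − t)‖curl u(t, x)‖`. [cite: MccormickEtAl2016, Thm 1.1 and Thm 3.2]
[cite: Chae2010, Thm 1.1] [cite: Miller2019, Thm 1.1] [cite: RobinsonRodrigoSadowski2016, Thm 12.3 and Lemma 6.11] -/
theorem typeI_face :
    ∃ c₁ c₂ : ℝ, 0 < c₁ ∧ 0 < c₂ ∧ ∀ (ν T : ℝ), 0 < ν → 0 < T →
      ∀ (u : ℝ → EuclideanSpace ℝ (Fin 3) → EuclideanSpace ℝ (Fin 3)) (p : ℝ → EuclideanSpace ℝ (Fin 3) → ℝ),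
      IsMaximalSmoothSolution ν 0 u p T → IsLerayHopfOn T ν 0 (u 0) u →
        (∀ t ∈ Ioo 0 T, ENNReal.ofReal (c₁ * (T - t) ^ (-(1 : ℝ))) ≤
            ∑' l : ℤ, (2 : ℝ≥0∞) ^ ((5 / 2 : ℝ) * (l : ℝ)) * blockL2 (u t) l) ∧
        (∀ t₀ : ℝ, t₀ < T → ∃ b ∈ Ioo (max t₀ 0) T,
            ENNReal.ofReal (c₂ / (T - b)) <
              Function.eHomSobolevSeminorm (5 / 2 : ℝ) (⇑EuclideanSpace.complexify ∘ u b)) ∧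
        (∀ M₀ : ℝ, M₀ < 1 → ∀ t₀ ∈ Ico 0 T,
            ∃ t ∈ Ico t₀ T, ∃ x : EuclideanSpace ℝ (Fin 3), M₀ < (T - t) * ‖fderiv ℝ (u t) x‖) ∧
        (∀ ε : ℝ, ε < 1 / 4 → ∀ a ∈ Ico 0 T,
            ∃ t ∈ Ico a T, ∃ x : EuclideanSpace ℝ (Fin 3), ∀ v w : EuclideanSpace ℝ (Fin 3), ‖v‖ = 1 → ‖w‖ = 1 →
              ⟪v, w⟫ = 0 → ∃ α β : ℝ,
                ε / (T - t) * (α ^ 2 + β ^ 2) < ⟪fderiv ℝ (u t) x (α • v + β • w), α • v + β • w⟫) ∧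
        (∀ ε : ℝ, ε < 1 / 4 → ∀ a ∈ Ico 0 T,
            ∃ t ∈ Ico a T, ∃ x : EuclideanSpace ℝ (Fin 3), ε < (T - t) * ‖curl (u t) x‖) := by
  obtain ⟨c₁, hc₁, H₁⟩ := lipRow_clock
  obtain ⟨c₂, hc₂, H₂⟩ := homSobolev52_weak_clock
  refine ⟨c₁, c₂, hc₁, hc₂, fun ν T hν hT u p hmax hLH => ⟨H₁ ν T hν hT u p hmax hLH, H₂ ν T hν hT u p hmax hLH,
    fun _ hM₀ _ ht₀ => ns_typeI_gradient_threshold hν hT hmax hLH hM₀ ht₀,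
    fun _ hε _ ha => ns_midStrain_typeI_threshold hν hmax hLH hε ha,
    fun _ hε _ ha => ns_vorticity_typeI_threshold hν hT hmax hLH hε ha⟩⟩

/-- **THE TYPE-I FACE ON THE INTERFACE**: every `W : CascadeWitness` yields `ν > 0`, `T > 0` and a maximal smooth
solution `(u, p)` of the unforced Navier–Stokes system on `ℝ³ × [0, T)`, Leray–Hopf from `u 0`
(`x5a_of_cascadeWitness'`), obeying the five rows of `typeI_face` with its constants `c₁, c₂`.
[cite: MccormickEtAl2016, Thm 1.1 and Thm 3.2] [cite: Chae2010, Thm 1.1] [cite: Miller2019, Thm 1.1]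
[cite: RobinsonRodrigoSadowski2016, Thm 12.3] -/
theorem typeI_face_of_cascadeWitness (W : CascadeWitness) :
    ∃ ν : ℝ, 0 < ν ∧ ∃ T : ℝ, 0 < T ∧
      ∃ (u : ℝ → EuclideanSpace ℝ (Fin 3) → EuclideanSpace ℝ (Fin 3)) (p : ℝ → EuclideanSpace ℝ (Fin 3) → ℝ),
        IsMaximalSmoothSolution ν 0 u p T ∧ IsLerayHopfOn T ν 0 (u 0) u ∧
        (∀ t ∈ Ioo 0 T, ENNReal.ofReal (typeI_face.choose * (T - t) ^ (-(1 : ℝ))) ≤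
            ∑' l : ℤ, (2 : ℝ≥0∞) ^ ((5 / 2 : ℝ) * (l : ℝ)) * blockL2 (u t) l) ∧
        (∀ t₀ : ℝ, t₀ < T → ∃ b ∈ Ioo (max t₀ 0) T,
            ENNReal.ofReal (typeI_face.choose_spec.choose / (T - b)) <
              Function.eHomSobolevSeminorm (5 / 2 : ℝ) (⇑EuclideanSpace.complexify ∘ u b)) ∧
        (∀ M₀ : ℝ, M₀ < 1 → ∀ t₀ ∈ Ico 0 T,
            ∃ t ∈ Ico t₀ T, ∃ x : EuclideanSpace ℝ (Fin 3), M₀ < (T - t) * ‖fderiv ℝ (u t) x‖) ∧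
        (∀ ε : ℝ, ε < 1 / 4 → ∀ a ∈ Ico 0 T,
            ∃ t ∈ Ico a T, ∃ x : EuclideanSpace ℝ (Fin 3), ∀ v w : EuclideanSpace ℝ (Fin 3), ‖v‖ = 1 → ‖w‖ = 1 →
              ⟪v, w⟫ = 0 → ∃ α β : ℝ,
                ε / (T - t) * (α ^ 2 + β ^ 2) < ⟪fderiv ℝ (u t) x (α • v + β • w), α • v + β • w⟫) ∧
        (∀ ε : ℝ, ε < 1 / 4 → ∀ a ∈ Ico 0 T,
            ∃ t ∈ Ico a T, ∃ x : EuclideanSpace ℝ (Fin 3), ε < (T - t) * ‖curl (u t) x‖) := by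
  obtain ⟨ν, hν, T, hT, u, p, hmax, hLH, -⟩ := x5a_of_cascadeWitness' W
  exact ⟨ν, hν, T, hT, u, p, hmax, hLH, typeI_face.choose_spec.choose_spec.2.2 ν T hν hT u p hmax hLH⟩

end Summit.NavierStokesRegularity.FluidComputer.TypeIFace

end
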